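import Literature.AlgebraicGeometry.Resolution.BlowupExceptionalFibreIrreducible
import Literature.AlgebraicGeometry.Resolution.ReesAlgebraExceptionalPrime
import Mathlib.RingTheory.GradedAlgebra.Radical
import HarnessLib

/-!
# The fibre of a blowing up over a point is irreducible when the radical of `𝔞·R[It]` is prime
# (CJS 2020 p. 46 «`F = π⁻¹(x) = Proj(A)`, `A = gr_𝔭(𝒪)⊗k`»; Liu Thm. 8.1.19 (b)) — the scheme-side trunk, any centre, any point

Topic: `Literature/AlgebraicGeometry/Resolution`. PROVED over the tree (`AffineBlowup.lean`: `Bl_I(Spec R) = Proj R[It]`;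
`ReesAlgebraExceptionalPrime.lean`: the prime case `I·R[It]` for a quasi-regular centre; `BlowupExceptionalFibreIrreducible.lean`: the
regular case `J_y = 𝔪_y`). For a ring `R`, ideals `I` (the centre) and `𝔞` (any ideal; the case of interest is a maximal `𝔞 = 𝔪 ⊇ I`):

* `isHomogeneous_map_reesAlgebra_of_ideal` — `𝔞·R[It]` is homogeneous (generated in degree `0`);
  `affineBlowup.mem_preimage_zeroLocus_iff_of_ideal` — a point of `Bl_I(Spec R)` lies over `V(𝔞)` iff its homogeneous prime
  contains `𝔞·R[It]` (both verbatim generalisations of the `𝔞 = I` lemmas of `ReesAlgebraExceptionalPrime.lean`).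
* `affineBlowup.exists_generic_preimage_zeroLocus_of_isPrime_radical` — **if `√(𝔞·R[It])` is PRIME then `π⁻¹(V(𝔞)) ⊆ Bl_I(Spec R)`
  (if non-empty) is the closure of the point `√(𝔞·R[It]) ∈ Proj R[It]`**, hence irreducible
  (`affineBlowup.isIrreducible_preimage_zeroLocus_of_isPrime_radical`). For `𝔞 = 𝔪` maximal and `R` local this reads:
  «`π⁻¹(𝔪) = Proj(R[It]/𝔪R[It])` is irreducible as soon as the FIBRE CONE `R[It]/𝔪R[It] = ⊕ Iⁿ/𝔪Iⁿ` (tree `FibreCone I`,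
  `FibreCone.lean`) has prime nilradical» — CJS LNM 2270 p. 46 «let `A = gr_𝔭(𝒪_{X,x}) ⊗_{𝒪/𝔭} k(x)` … `F = Proj(A)`».
* `IsBlowup.isIrreducible_preimage_singleton_of_isPrime_radical` — **transport to any blowing up `π : X' ⟶ X` along `J` and any point
  `y` with a point over it**: if `√(𝔪_y·𝒪_{X,y}[J_y t])` is prime then `π⁻¹(y)` is irreducible (base change to `Spec 𝒪_{X,y}`,
  `IsBlowup.pullback_snd_of_flat` + `comap_fromSpecStalk_eq_affineBlowupIdealSheaf` + uniqueness, as in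
  `IsBlowup.isIrreducible_preimage_singleton`).

USE (cell res-hironaka, W4.2, res-type-053's depth kit): the hypothesis `hF : IsIrreducible (f⁻¹ {x_n})` of
`Moving.preimage_pt_subset_of_hasSandwichAt_of_curve_centre` (p527422) / `Sigma.StepProjectionσ.preimage_pt_subset_…` (p532169) is reduced
to PURE COMMUTATIVE ALGEBRA on `𝒪_{X_n,x_n}`: «the nilradical of the fibre cone `gr_𝔭(𝒪)⊗k` is prime». At a W-top point
(`ē_x = dim 𝒪_{X,x}`) this holds for the point centre (`(gr_𝔪 𝒪 ⊗ k̄)_red` is a polynomial ring: the tangent cone is set-theoretically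
the directrix) and, for a permissible positive-dimensional centre, via the Hironaka–Grothendieck isomorphism
`(gr_𝔭(𝒪)⊗k)[T₁,…,T_r] ≅ gr_𝔪(𝒪)` (Herrmann–Ikeda–Orbanz Thm. (21.9)/(21.10), Cor. (21.11)) — neither algebra step is done here.
No named facts are introduced; [folklore]-level transport throughout.

## Sources
* V. Cossart, U. Jannsen, S. Saito, LNM 2270 (2020), proof of Thm. 3.10, p. 46 («`F = Proj(A)`»). [CossartJannsenSaito2020]
* Q. Liu, *Algebraic Geometry and Arithmetic Curves*, OUP 2002, §8.1 Thm. 1.19 (b). [Liu2002]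
* M. Herrmann, S. Ikeda, U. Orbanz, *Equimultiplicity and Blowing up* (1988), Thm. (21.9)/(21.10), Cor. (21.11) (context only). [HerrmannIkedaOrbanz1988]
-/

noncomputable section

open CategoryTheory CategoryTheory.Limits AlgebraicGeometry TopologicalSpace IsLocalRing

namespace Literature.AlgebraicGeometry.Resolution

universe u

open Scheme.IdealSheafData

/-! ## Algebra: `𝔞·R[It]`, its zero locus on `Bl_I(Spec R)`, and the prime-radical case -/

section Algebra

variable {R : Type u} [CommRing R] (I 𝔞 : Ideal R)

/-- `𝔞 · R[It]` is a homogeneous ideal of the Rees algebra `R[It]` (generated in degree `0`), for ANY ideal `𝔞` of `R`.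
[cite: Liu2002, Thm. 8.1.19 (b)] -/
theorem isHomogeneous_map_reesAlgebra_of_ideal :
    (𝔞.map (algebraMap R (reesAlgebra I))).IsHomogeneous (reesGrading I) := by
  refine Ideal.homogeneous_span (reesGrading I) _ ?_
  rintro _ ⟨r, -, rfl⟩
  exact ⟨0, (mem_reesGrading_iff I).mpr ⟨r, by simp [Polynomial.monomial_zero_left]⟩⟩

/-- A point of `Bl_I(Spec R)` lies over `V(𝔞)` iff its homogeneous prime contains `𝔞 · R[It]` (any ideal `𝔞`).
[cite: Liu2002, Thm. 8.1.19 (b)] -/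
theorem affineBlowup.mem_preimage_zeroLocus_iff_of_ideal (q : affineBlowup I) :
    q ∈ (affineBlowup.π I).base ⁻¹' PrimeSpectrum.zeroLocus (𝔞 : Set R) ↔
      𝔞.map (algebraMap R (reesAlgebra I)) ≤ q.asHomogeneousIdeal.toIdeal := by
  rw [Ideal.map_le_iff_le_comap]
  change (𝔞 : Set R) ⊆ ((affineBlowup.π I).base q).asIdeal ↔ _
  constructor
  · intro h r hr
    exact (affineBlowup.mem_π_apply_iff q r).mp (h hr)
  · intro h r hr
    exact (affineBlowup.mem_π_apply_iff q r).mpr (h hr)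

/-- **If `√(𝔞·R[It])` is prime, `π⁻¹(V(𝔞)) ⊆ Bl_I(Spec R)` is the closure of ONE of its points** — the relevant homogeneous prime
`√(𝔞·R[It])` — provided it is non-empty (which makes that prime relevant). [cite: Liu2002, Thm. 8.1.19 (b)] -/
theorem affineBlowup.exists_generic_preimage_zeroLocus_of_isPrime_radical
    (hP : ((𝔞.map (algebraMap R (reesAlgebra I))).radical).IsPrime)
    (hne : ((affineBlowup.π I).base ⁻¹' PrimeSpectrum.zeroLocus (𝔞 : Set R)).Nonempty) :
    ∃ p ∈ (affineBlowup.π I).base ⁻¹' PrimeSpectrum.zeroLocus (𝔞 : Set R),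
      (affineBlowup.π I).base ⁻¹' PrimeSpectrum.zeroLocus (𝔞 : Set R) = closure {p} := by
  let H : HomogeneousIdeal (reesGrading I) :=
    ⟨(𝔞.map (algebraMap R (reesAlgebra I))).radical, (isHomogeneous_map_reesAlgebra_of_ideal I 𝔞).radical⟩
  have hHq : ∀ q : affineBlowup I, q ∈ (affineBlowup.π I).base ⁻¹' PrimeSpectrum.zeroLocus (𝔞 : Set R) ↔
      H.toIdeal ≤ q.asHomogeneousIdeal.toIdeal := fun q => by
    rw [affineBlowup.mem_preimage_zeroLocus_iff_of_ideal]
    exact (q.isPrime.radical_le_iff).symm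
  have hrel : ¬ HomogeneousIdeal.irrelevant (reesGrading I) ≤ H := by
    obtain ⟨q, hq⟩ := hne
    intro hle
    exact q.not_irrelevant_le (le_trans hle ((hHq q).mp hq))
  let P : affineBlowup I :=
    { asHomogeneousIdeal := H
      isPrime := hP
      not_irrelevant_le := hrel }
  have hcl : (affineBlowup.π I).base ⁻¹' PrimeSpectrum.zeroLocus (𝔞 : Set R) = closure {P} := by
    ext q
    rw [hHq q]
    exact (toIdeal_le_toIdeal_iff (I := H) (J := (q : ProjectiveSpectrum (reesGrading I)).asHomogeneousIdeal)).trans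
      ((ProjectiveSpectrum.as_ideal_le_as_ideal (reesGrading I) P q).trans
        (ProjectiveSpectrum.le_iff_mem_closure (reesGrading I) P q))
  refine ⟨P, ?_, hcl⟩
  rw [hcl]; exact subset_closure rfl

/-- **If `√(𝔞·R[It])` is prime then `π⁻¹(V(𝔞)) ⊆ Bl_I(Spec R)` is irreducible** (given one point of it). For `R` local and `𝔞 = 𝔪`:
the closed fibre `Proj(R[It]/𝔪R[It])` of the blowing up is irreducible as soon as the fibre cone `⊕ Iⁿ/𝔪Iⁿ` has prime nilradical.
[cite: CossartJannsenSaito2020, Thm. 3.10 (proof, p. 46)] [cite: Liu2002, Thm. 8.1.19 (b)] -/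
theorem affineBlowup.isIrreducible_preimage_zeroLocus_of_isPrime_radical
    (hP : ((𝔞.map (algebraMap R (reesAlgebra I))).radical).IsPrime)
    (hne : ((affineBlowup.π I).base ⁻¹' PrimeSpectrum.zeroLocus (𝔞 : Set R)).Nonempty) :
    IsIrreducible ((affineBlowup.π I).base ⁻¹' PrimeSpectrum.zeroLocus (𝔞 : Set R)) := by
  obtain ⟨p, -, h⟩ := affineBlowup.exists_generic_preimage_zeroLocus_of_isPrime_radical I 𝔞 hP hne
  rw [h]
  exact isIrreducible_singleton.closure

end Algebra

/-! ## Transport to a blowing up `π : X' ⟶ X` and the fibre over a point -/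

/-- The zero locus of the maximal ideal of a local ring is its closed point.
[cite: AtiyahMacdonald1969, Ch. 1 Prop. 1.6 ff. / Ex. 15 (Zariski topology on Spec; kernel bookkeeping)] -/
theorem PrimeSpectrum.zeroLocus_maximalIdeal_eq {A : Type u} [CommRing A] [IsLocalRing A] :
    PrimeSpectrum.zeroLocus ((maximalIdeal A : Ideal A) : Set A) = {closedPoint A} := by
  ext q
  rw [PrimeSpectrum.mem_zeroLocus, Set.mem_singleton_iff]
  constructor
  · intro h
    apply PrimeSpectrum.ext
    exact ((IsLocalRing.maximalIdeal.isMaximal A).eq_of_le q.isPrime.ne_top h).symm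
  · rintro rfl
    exact le_rfl

/-- **THE FIBRE OF A BLOWING UP OVER A POINT IS IRREDUCIBLE WHEN THE FIBRE CONE HAS PRIME RADICAL.** Let `π : X' ⟶ X` be a blowing
up along `J` (`IsBlowup π J`), `y ∈ X` a point with SOME point `x'` over it, and suppose the radical of `𝔪_y · 𝒪_{X,y}[J_y t]` in the
Rees algebra of the stalk ideal `J_y` is prime (i.e. the fibre cone `⊕ J_yⁿ/𝔪_y J_yⁿ` is irreducible). Then `π⁻¹(y)` is irreducible.
Proof: blowing ups commute with the flat `Spec 𝒪_{X,y} ⟶ X` and are unique, so `π⁻¹(y)` is the continuous image of the fibre of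
`Bl_{J_y}(Spec 𝒪_{X,y}) ⟶ Spec 𝒪_{X,y}` over the closed point, irreducible by the algebraic lemma. [cite: CossartJannsenSaito2020, Thm. 3.10 (proof, p. 46)]
[cite: Liu2002, Thm. 8.1.19 (b)] -/
theorem IsBlowup.isIrreducible_preimage_singleton_of_isPrime_radical {X X' : Scheme.{u}} {π : X' ⟶ X}
    {J : X.IdealSheafData} (hπ : IsBlowup π J) (y : X)
    (hP : (((maximalIdeal (X.presheaf.stalk y)).map
      (algebraMap (X.presheaf.stalk y) (reesAlgebra (stalkIdeal J y)))).radical).IsPrime)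
    {x' : X'} (hx' : π x' = y) : IsIrreducible (π ⁻¹' {y}) := by
  classical
  -- base change to `Spec 𝒪_{X,y}`: a blowing up along `(J_y)~`, hence `≅ Proj 𝒪_{X,y}[J_y t]`
  haveI : Flat (X.fromSpecStalk y) := flat_fromSpecStalk X y
  have hB : IsBlowup (pullback.snd π (X.fromSpecStalk y)) (affineBlowup.idealSheaf (stalkIdeal J y)) := by
    have h := hπ.pullback_snd_of_flat (X.fromSpecStalk y)
    rwa [comap_fromSpecStalk_eq_affineBlowupIdealSheaf] at h
  obtain ⟨e, he, -⟩ := (affineBlowup.isBlowup (stalkIdeal J y)).unique hB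
  -- the fibre over `y` is the image of the fibre of the affine model over the closed point
  have himage : π ⁻¹' {y} =
      (fun a => pullback.fst π (X.fromSpecStalk y) (e.hom a)) ''
        ((affineBlowup.π (stalkIdeal J y)) ⁻¹' {closedPoint (X.presheaf.stalk y)}) := by
    ext z
    constructor
    · intro hz
      rw [Set.mem_preimage, Set.mem_singleton_iff] at hz
      obtain ⟨w, hw⟩ := mem_range_pullback_fst_fromSpecStalk_of_eq π y (x' := z) hz
      obtain ⟨a, rfl⟩ := (Scheme.homeoOfIso e).surjective w
      refine ⟨a, ?_, hw⟩
      change affineBlowup.π (stalkIdeal J y) a = closedPoint (X.presheaf.stalk y)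
      apply (X.fromSpecStalk y).isEmbedding.injective
      rw [Scheme.fromSpecStalk_closedPoint, ← he, Scheme.Hom.comp_apply, ← Scheme.Hom.comp_apply,
        ← pullback.condition, Scheme.Hom.comp_apply]
      rw [← Scheme.homeoOfIso_apply, hw, hz]
    · rintro ⟨a, ha, rfl⟩
      have ha' : affineBlowup.π (stalkIdeal J y) a = closedPoint (X.presheaf.stalk y) := ha
      change (e.hom ≫ pullback.fst π (X.fromSpecStalk y) ≫ π) a = y
      rw [pullback.condition, ← Category.assoc, he, Scheme.Hom.comp_apply, ha',
        Scheme.fromSpecStalk_closedPoint]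
  -- the affine fibre is non-empty (it maps onto `π⁻¹(y) ∋ x'`) and irreducible by the algebraic lemma
  have hmem : x' ∈ π ⁻¹' {y} := hx'
  rw [himage] at hmem
  obtain ⟨a₀, ha₀, -⟩ := hmem
  have hV := PrimeSpectrum.zeroLocus_maximalIdeal_eq (A := X.presheaf.stalk y)
  have hne : ((affineBlowup.π (stalkIdeal J y)).base ⁻¹'
      PrimeSpectrum.zeroLocus ((maximalIdeal (X.presheaf.stalk y) : Ideal _) : Set (X.presheaf.stalk y))).Nonempty :=
    ⟨a₀, by rw [hV]; exact ha₀⟩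
  have hfib := affineBlowup.isIrreducible_preimage_zeroLocus_of_isPrime_radical (stalkIdeal J y)
    (maximalIdeal (X.presheaf.stalk y)) hP hne
  rw [hV] at hfib
  rw [himage]
  exact hfib.image _ ((Scheme.Hom.continuous _).comp (Scheme.Hom.continuous _)).continuousOn

end Literature.AlgebraicGeometry.Resolution

end
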